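import Summits.ABC.ABC.Theorems.TwistAmplificationMazurKaneLawDetToolRoots

-- Summit.ABC.ABC is the mandated summit-side namespace (single-conjunct summit); the lakefile sets the same option tree-wide.
set_option linter.dupNamespace false

/-!
# Square congruences as unions of root lattices (crux stmt-ABC-2757, DE tool, stubs `de_sqCongr_card_le_sum_roots` and `de_card_roots_le`)

Two elementary counting facts for the line `critical-kloosterman-powerful-moduli` of the crux
`Summit.ABC.ABC.Theses.TwistAmplification.MazurKaneLaw` (the "DE tool": the multiplicative energy
modulo `q` reduces to counting pairs `(A, B) ∈ [1, S]²` with `A² C ≡ B² D (mod q)`, `B` a unit).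

* `de_sqCongr_card_le_sum_roots`: every such pair lies on the root lattice `A ≡ λ B (mod q)` of the
  class `λ := A · B⁻¹ ∈ ZMod q`, and this class satisfies `λ² C = D`; hence the number of pairs is at
  most the sum, over the roots `λ` of `λ² C = D`, of the number of pairs on the lattice of `λ`
  (`Finset.card_biUnion_le`).
* `de_card_roots_le`: if `C` and `D` are units of `ZMod q`, the roots `λ` of `λ² C = D` number at most
  the square roots of unity in `ZMod q`: a root `λ₀` is a unit and `λ ↦ λ · λ₀⁻¹` injects the roots
  into `{ρ : ρ² = 1}`.

No new definitions; both statements are folklore bookkeeping.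
-/

namespace Summit.ABC.ABC.Theorems.MazurKaneLaw

open Finset

/-- The class `λ := A · B⁻¹` of a pair `(A, B)` with `B` a unit modulo `q` and `A² C = B² D` in
`ZMod q` is a root of `λ² C = D`, and `A = λ B`. [folklore] -/
theorem de_rootClass_of_sqCongr {q : ℕ} {C D a b : ZMod q} (hb : b * b⁻¹ = 1)
    (h : a ^ 2 * C = b ^ 2 * D) : (a * b⁻¹) ^ 2 * C = D ∧ a = a * b⁻¹ * b := by
  refine ⟨?_, ?_⟩
  · calc (a * b⁻¹) ^ 2 * C = a ^ 2 * C * b⁻¹ ^ 2 := by ring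
      _ = D * (b * b⁻¹) ^ 2 := by rw [h]; ring
      _ = D := by rw [hb, one_pow, mul_one]
  · calc a = a * (b * b⁻¹) := by rw [hb, mul_one]
      _ = a * b⁻¹ * b := by ring

/-- **Square congruence covered by root lattices.**  For `C, D ∈ ZMod q` the pairs
`(A, B) ∈ [1, S]²` with `gcd(B, q) = 1` and `A² C = B² D` in `ZMod q` number at most
`∑_{λ : λ² C = D} #{(A, B) ∈ [1, S]² : A = λ B in ZMod q}`: each pair lies on the root lattice of
its class `λ = A · B⁻¹`. (The hypothesis `IsUnit C` is not needed.) [folklore] -/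
theorem de_sqCongr_card_le_sum_roots : ∀ (q : ℕ) [NeZero q] (C D : ZMod q) (S : ℕ), IsUnit C → ((Finset.Icc (1 : ℤ) S ×ˢ Finset.Icc (1 : ℤ) S).filter (fun p : ℤ × ℤ => Int.gcd p.2 q = 1 ∧ (p.1 : ZMod q) ^ 2 * C = (p.2 : ZMod q) ^ 2 * D)).card ≤ ∑ lam ∈ Finset.univ.filter (fun lam : ZMod q => lam ^ 2 * C = D), ((Finset.Icc (1 : ℤ) S ×ˢ Finset.Icc (1 : ℤ) S).filter (fun p : ℤ × ℤ => (p.1 : ZMod q) = lam * (p.2 : ZMod q))).card := by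
  intro q _ C D S _
  refine le_trans (Finset.card_le_card ?_) Finset.card_biUnion_le
  intro p hp
  rw [Finset.mem_filter] at hp
  obtain ⟨hbox, hgcd, heq⟩ := hp
  have hb : (p.2 : ZMod q) * (p.2 : ZMod q)⁻¹ = 1 :=
    ZMod.coe_int_mul_inv_eq_one (Int.isCoprime_iff_gcd_eq_one.mpr hgcd)
  obtain ⟨hroot, hlat⟩ := de_rootClass_of_sqCongr hb heq
  rw [Finset.mem_biUnion]
  exact ⟨(p.1 : ZMod q) * (p.2 : ZMod q)⁻¹, Finset.mem_filter.mpr ⟨Finset.mem_univ _, hroot⟩,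
    Finset.mem_filter.mpr ⟨hbox, hlat⟩⟩

/-- **Number of roots.**  If `C` and `D` are units of `ZMod q`, the solutions `λ` of `λ² C = D`
number at most the square roots of unity in `ZMod q`: a solution `λ₀` is a unit (`λ₀² = D C⁻¹`), and
`λ ↦ λ λ₀⁻¹` maps the solutions injectively into `{ρ : ρ² = 1}`. [folklore] -/
theorem de_card_roots_le : ∀ (q : ℕ) [NeZero q] (C D : ZMod q), IsUnit C → IsUnit D → (Finset.univ.filter (fun lam : ZMod q => lam ^ 2 * C = D)).card ≤ Nat.card {ρ : ZMod q // ρ ^ 2 = 1} := by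
  intro q _ C D hC hD
  rw [Nat.subtype_card (Finset.univ.filter (fun ρ : ZMod q => ρ ^ 2 = 1)) (fun x => by simp)]
  rcases (Finset.univ.filter (fun lam : ZMod q => lam ^ 2 * C = D)).eq_empty_or_nonempty with
    h0 | ⟨lam0, hlam0⟩
  · rw [h0, Finset.card_empty]
    exact Nat.zero_le _
  · have hlam0' : lam0 ^ 2 * C = D := (Finset.mem_filter.mp hlam0).2
    have hu2 : IsUnit (lam0 ^ 2) := by
      have h : IsUnit (lam0 ^ 2 * C) := by rw [hlam0']; exact hD
      exact isUnit_of_mul_isUnit_left h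
    obtain ⟨u, hu⟩ := (isUnit_pow_iff two_ne_zero).mp hu2
    refine Finset.card_le_card_of_injOn (fun lam => lam * ↑u⁻¹) ?_ ?_
    · intro lam hlam
      rw [Finset.mem_coe, Finset.mem_filter] at hlam ⊢
      refine ⟨Finset.mem_univ _, ?_⟩
      have hsq : lam ^ 2 = lam0 ^ 2 := hC.mul_left_inj.mp (hlam.2.trans hlam0'.symm)
      calc (lam * ↑u⁻¹) ^ 2 = lam ^ 2 * (↑u⁻¹) ^ 2 := by ring
        _ = ((u : ZMod q) * ↑u⁻¹) ^ 2 := by rw [hsq, ← hu]; ring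
        _ = 1 := by rw [Units.mul_inv, one_pow]
    · intro a _ b _ hab
      exact (Units.mul_left_inj _).mp hab

end Summit.ABC.ABC.Theorems.MazurKaneLaw
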